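/-
Copyright: the b2b-balaban T⁴-continuum CRUX team, row NE7b, leaf lineage `t4-ne7b-formalise-leaf-02` (gen 129). Project licence.
-/
import Mathlib.Analysis.InnerProductSpace.PiL2
import Mathlib.LinearAlgebra.CrossProduct

/-!
# THE BY-VALUE CONSTANTS OF THE PLAQUETTE CUBIC, KERNEL-CERTIFIED: the block entry `|u·(v × w)| ≤ 1` (Hadamard in `ℝ³`), the
# cross-product block `‖w × v‖ ≤ ‖w‖‖v‖`, and the ROW CONSTANT `‖a + b‖ + ‖a + c‖ + ‖b − c‖ ≤ 3√3·ρ` — SHARP (row NE7b, node U5c;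
# letter (ℓ1) of the windowed road, the `h`-half of the desk's BILL item 1)

Cell `pub-balaban`, sub-cell `t4`, spine estimate NE7b (`T4WeightBudget.RelWeightBound`; the cell's OWN estimate — NOT PRINTED in
[Bałaban 1983–89], NOT PROVED).  Crux-route work under `Spine/NE7b/` by the row's E-side ∕ key-readings leaf lineage; NOTHING of
Bałaban's is named or asserted; no `T4Continuum/Support` leaf typed; no `def`; zero `sorry`; imports Mathlib only.

WHY.  The windowed-convexity road (R-P1) reads its modulus on print's small-field window as `λ = 2σ − h` with `h` the Hessian-smallness
letter of the anharmonic part (`…NE7b.ConvexWindowSuppliers` §2, `…ConvexWindowSuppliersBox`, `…ConvexWindowSuppliersLocal`).  BY VALUE the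
`h`-half was closed on the desk and in ideation BY HAND and BY NUMERICS (PRICING-NE7b v89 F463 on idea-1's T-71; riders ρ-ne7bref-g74-1,
ρ-ne7bref-g75-1): at leading order about the background the anharmonic part of the `SU(2)` Wilson plaquette action in exponential
coordinates is the PLAQUETTE CUBIC `P₃(x) = det(x₁,x₂,x₃) + det(x₁,x₂,x₄) − det(x₁,x₃,x₄) − det(x₂,x₃,x₄)` of the four bond vectors
`x_b ∈ ℝ³` (T-71 (i), F463 (i) «BY HAND via BCH»); its Hessian has the `4 × 4` block table `(1,2) −[x₃+x₄]_×, (1,3) +[x₂+x₄]_×, (1,4) +[x₂−x₃]_×,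
(2,3) +[x₄−x₁]_×, (2,4) −[x₁+x₃]_×, (3,4) +[x₁+x₂]_×` with `[w]_× v := w × v` and zero diagonal blocks (T-71 (ii), F463 (ii)); and the desk's
rider ρ-ne7bref-g74-1 states, with a hand proof, (a) the block norm of `[w]_×` is `|w|`, (b) every ROW of the block-norm matrix has the shape
`|a+b| + |a+c| + |b−c|` over three bond vectors, (c) `G := max_{|a|,|b|,|c| ≤ 1}(|a+b| + |a+c| + |b−c|) = 3√3`, attained at `b·c = −½`,
`a = b + c` — whence by the block Schur test `c_p ≤ 3√3` per plaquette and, each bond lying in `2(d−1) = 6` plaquettes, `c_latt ≤ 18√3`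
(«lg h ∈ [−5.02, −4.97] at ℓ⋆(1), room ≥ 4.0 orders against γ_vec»); ρ-ne7bref-g75-1 adds the third-derivative block table of the
same cubic: `t = 1` EXACTLY on the triples of pairwise distinct bonds (the entry is `±det(u,v,w)` on unit vectors) and `0` otherwise.
The desk marked these constants «hand-proved ∕ desk-certified, NEEDS-CONSTANT 0».  THIS FILE turns the hand proofs (a), (c) and the entry
bound `|det(u,v,w)| ≤ |u||v||w|` into KERNEL THEOREMS — [folklore] inequalities of three vectors, with their equality cases, so that the two
numbers `1` and `3√3` the by-value table rests on are certified and SHARP.  (Successor clause (xx)(4) of HANDOFF § [NE7bLEAF02-G128-HANDOFF]: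
«a kernel version of T-71's ∕ ρ-g75-1's block table for the Wilson cubic».)

WHAT IS PROVED ([folklore]; §1 in Mathlib's dot-product currency on `Fin 3 → ℝ` — `v ⬝ᵥ v` is the squared Euclidean length, `⨯₃` is
`Mathlib.LinearAlgebra.CrossProduct`; §2–§3 in ANY real inner product space `F`):
* §1 **`cross_dot_self_le`** (the block `[w]_×`: `|w × v|² ≤ |w|²|v|²`, from LAGRANGE's identity = Mathlib's `cross_dot_cross`) with the
  equality case `cross_dot_self_of_dotProduct_eq_zero` (`v ⊥ w` — so the block norm IS `|w|`, (a)), **`triple_product_sq_le`** (HADAMARD for three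
  vectors: `(u·(v × w))² ≤ (u·u)(v·v)(w·w)` — Cauchy–Schwarz in `ℝ³` FROM Lagrange, then the block bound),
  `det_sq_le` (the same for `det ![u, v, w]`, by Mathlib's `triple_product_eq_det`), **`abs_triple_product_le_one`** (the cubic's block ENTRY:
  `|u·(v × w)| ≤ 1` on vectors of length `≤ 1`), `abs_triple_product_le` (`≤ ρ³` on vectors of length `≤ ρ`) and the sharpness `triple_product_basis`
  (`= 1` at the standard basis) — ρ-g75-1's `t = 1`.
* §2 THE ROW CONSTANT (c): `norm_add_sq_add_norm_add_sq_le` (`‖a+b‖² + ‖a+c‖² ≤ 4ρ² + 2ρ‖b+c‖`, CS), `norm_sub_sq_le` (parallelogram: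
  `‖b−c‖² ≤ 4ρ² − ‖b+c‖²`), the two AM–GM legs `two_norms_step` (`(‖a+b‖ + ‖a+c‖)·√3 ≤ 5ρ + u`, certificate `(ρ − u)²`) and `sub_norm_step`
  (`‖b−c‖·(2√3)·ρ ≤ 7ρ² − u²`, certificate `(ρ² − u²)²`), and **`row_le`**: `‖a‖, ‖b‖, ‖c‖ ≤ ρ ⟹ ‖a+b‖ + ‖a+c‖ + ‖b−c‖ ≤ 3·√3·ρ`
  (certificate `(u − ρ)²`; `u := ‖b+c‖`); the unit form `row_le_one`; SHARPNESS **`row_sharp`**: unit vectors `a, b, c` of `EuclideanSpace ℝ (Fin 2)`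
  (`b·c = −½`, `a = b + c`) with `‖a+b‖ + ‖a+c‖ + ‖b−c‖ = 3·√3` — so `G = 3√3` exactly.
* §3 THE FOUR PLAQUETTE ROWS (b)+(c): for bond vectors `x₁, x₂, x₃, x₄` of length `≤ ρ`,
  `‖x₃+x₄‖ + ‖x₂+x₄‖ + ‖x₂−x₃‖`, `‖x₃+x₄‖ + ‖x₄−x₁‖ + ‖x₁+x₃‖`, `‖x₂+x₄‖ + ‖x₄−x₁‖ + ‖x₁+x₂‖`, `‖x₂−x₃‖ + ‖x₁+x₃‖ + ‖x₁+x₂‖` are ALL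
  `≤ 3·√3·ρ` (`plaquetteRow₁_le` … `plaquetteRow₄_le`: each is `row_le` after a relabelling ∕ sign flip), and the lattice arithmetic
  `latticeRow_le` (six such rows, one per plaquette through a bond: `≤ 18·√3·ρ`).
* §4 THE CUBIC ON BOND VECTORS OF LENGTH `≤ 1` ∕ `≤ ρ`: `plaquetteCubic_abs_le_four` (the trivial sup bound `|P₃| ≤ 4` from four block entries),
  `plaquetteCubic_abs_le` (`|P₃| ≤ 4ρ³`) and the
  TETRAHEDRAL CERTIFICATE **`plaquetteCubic_tetrahedral`** (unit `x₁ = (1,1,1)∕√3, x₂ = (−1,1,1)∕√3, x₃ = (1,−1,1)∕√3, x₄ = (−1,−1,1)∕√3`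
  give `P₃ = 16·√3∕9 = 16∕(3√3) = 3.0792…` — the desk's E-ne7bref-g74-1 value of `s₃` from below, correcting T-71's `3.047`).

NOT HERE (honest): the IDENTIFICATION of `P₃` with the cubic Taylor term of the Wilson plaquette action and of its Hessian ∕ third-derivative
blocks with `±[x_k ± x_k′]_×` ∕ `±det` (T-71 (i)–(ii), F463 — BY HAND there, a READING here, displayed by any consumer); the sharp values
`s₃ = 16∕(3√3)` (needs `c_p`), `c_p = 8∕√3` and the lattice lower bound `c_latt ≥ 16√3` (numerics + an algebraic certificate on the desk, not typed); the block
Schur test itself (`…ConvexWindowSuppliersLocal` §5, BY NAME for a consumer); which window, chart and `ε_k` of Bałaban's the table is read on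
((A3) ∕ (A1c), NC-NE7b-α UNRULED); anything of Bałaban's.  NE7b NOT PRINTED ∕ NOT PROVED; spine PROVED 0∕9; rung (B)+1 on a FINITE torus —
NOT infinite volume, NOT the mass gap, NOT Clay.
HONEST DEPENDENCY: continuum YM on T⁴ ⇐ BetaPertH ∧ nine spine estimates (0/9 proved); BetaPertH ⇐ (D1) ∧ (D4) ∧ CAP+tail.
-/

set_option autoImplicit false

noncomputable section

open Real Matrix
open scoped RealInnerProductSpace

namespace Summit.QuantumFields.BalabanUV.T4Continuum.NE7b.PlaquetteCubicConstants

/-! ## §1 The block entries: Lagrange, Cauchy–Schwarz and Hadamard for three vectors of `ℝ³` (dot-product currency) -/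

section R3

/-- **THE CROSS-PRODUCT BLOCK `[w]_× : v ↦ w × v` HAS NORM AT MOST `|w|`**: `|w × v|² ≤ |w|²·|v|²` — Lagrange's identity
`|w × v|² = |w|²|v|² − (w·v)²` (Mathlib's `cross_dot_cross`). [folklore] -/
theorem cross_dot_self_le (w v : Fin 3 → ℝ) : (w ⨯₃ v) ⬝ᵥ (w ⨯₃ v) ≤ (w ⬝ᵥ w) * (v ⬝ᵥ v) := by
  rw [cross_dot_cross, dotProduct_comm v w]
  nlinarith [mul_self_nonneg (w ⬝ᵥ v)]

/-- … with EQUALITY on vectors orthogonal to `w` (`w·v = 0`): the block norm of `[w]_×` IS `|w|` (ρ-ne7bref-g74-1 (a)). [folklore] -/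
theorem cross_dot_self_of_dotProduct_eq_zero (w v : Fin 3 → ℝ) (h : w ⬝ᵥ v = 0) :
    (w ⨯₃ v) ⬝ᵥ (w ⨯₃ v) = (w ⬝ᵥ w) * (v ⬝ᵥ v) := by
  rw [cross_dot_cross, h, zero_mul, sub_zero]

/-- **HADAMARD'S INEQUALITY FOR THREE VECTORS OF `ℝ³`** (triple-product form): `(u·(v × w))² ≤ (u·u)(v·v)(w·w)` — Cauchy–Schwarz against
`v × w`, then the block bound `|v × w|² ≤ |v|²|w|²`. [folklore] -/
theorem triple_product_sq_le (u v w : Fin 3 → ℝ) :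
    (u ⬝ᵥ (v ⨯₃ w)) ^ 2 ≤ (u ⬝ᵥ u) * (v ⬝ᵥ v) * (w ⬝ᵥ w) := by
  have hu : 0 ≤ u ⬝ᵥ u := by unfold dotProduct; exact Finset.sum_nonneg fun i _ => mul_self_nonneg (u i)
  -- Cauchy–Schwarz against `y := v × w` FROM Lagrange: the defect is `|u × y|² ≥ 0`
  have hcs : (u ⬝ᵥ (v ⨯₃ w)) ^ 2 ≤ (u ⬝ᵥ u) * ((v ⨯₃ w) ⬝ᵥ (v ⨯₃ w)) := by
    have h0 : 0 ≤ (u ⨯₃ (v ⨯₃ w)) ⬝ᵥ (u ⨯₃ (v ⨯₃ w)) := by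
      unfold dotProduct; exact Finset.sum_nonneg fun i _ => mul_self_nonneg _
    rw [cross_dot_cross, dotProduct_comm (v ⨯₃ w) u] at h0
    nlinarith [h0]
  calc (u ⬝ᵥ (v ⨯₃ w)) ^ 2 ≤ (u ⬝ᵥ u) * ((v ⨯₃ w) ⬝ᵥ (v ⨯₃ w)) := hcs
    _ ≤ (u ⬝ᵥ u) * ((v ⬝ᵥ v) * (w ⬝ᵥ w)) := mul_le_mul_of_nonneg_left (cross_dot_self_le v w) hu
    _ = (u ⬝ᵥ u) * (v ⬝ᵥ v) * (w ⬝ᵥ w) := by ring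

/-- **HADAMARD, DETERMINANT FORM**: `(det[u, v, w])² ≤ (u·u)(v·v)(w·w)` for a real `3 × 3` matrix with rows `u, v, w`
(`u·(v × w) = det[u, v, w]`, Mathlib's `triple_product_eq_det`). [folklore] -/
theorem det_sq_le (u v w : Fin 3 → ℝ) :
    (Matrix.det ![u, v, w]) ^ 2 ≤ (u ⬝ᵥ u) * (v ⬝ᵥ v) * (w ⬝ᵥ w) := by
  rw [← triple_product_eq_det]
  exact triple_product_sq_le u v w

/-- **THE CUBIC'S BLOCK ENTRY IS AT MOST ONE**: for vectors of length `≤ 1` (`u·u, v·v, w·w ≤ 1`), `|u·(v × w)| ≤ 1` — the third-derivative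
block entry `±det(u,v,w)` of the plaquette cubic on a triple of pairwise distinct bonds (ρ-ne7bref-g75-1: «t = 1 on the 24 triples»). [folklore] -/
theorem abs_triple_product_le_one (u v w : Fin 3 → ℝ) (hu : u ⬝ᵥ u ≤ 1) (hv : v ⬝ᵥ v ≤ 1) (hw : w ⬝ᵥ w ≤ 1) :
    |u ⬝ᵥ (v ⨯₃ w)| ≤ 1 := by
  have h := triple_product_sq_le u v w
  have hv0 : 0 ≤ v ⬝ᵥ v := by unfold dotProduct; exact Finset.sum_nonneg fun i _ => mul_self_nonneg (v i)
  have hw0 : 0 ≤ w ⬝ᵥ w := by unfold dotProduct; exact Finset.sum_nonneg fun i _ => mul_self_nonneg (w i)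
  have h2 : (u ⬝ᵥ u) * (v ⬝ᵥ v) ≤ 1 := by
    calc (u ⬝ᵥ u) * (v ⬝ᵥ v) ≤ 1 * 1 := mul_le_mul hu hv hv0 zero_le_one
      _ = 1 := by ring
  have h1 : (u ⬝ᵥ u) * (v ⬝ᵥ v) * (w ⬝ᵥ w) ≤ 1 := by
    calc (u ⬝ᵥ u) * (v ⬝ᵥ v) * (w ⬝ᵥ w) ≤ 1 * 1 := mul_le_mul h2 hw hw0 zero_le_one
      _ = 1 := by ring
  rw [abs_le]
  constructor <;> nlinarith [sq_nonneg (u ⬝ᵥ (v ⨯₃ w) - 1), sq_nonneg (u ⬝ᵥ (v ⨯₃ w) + 1)]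

/-- **THE BLOCK ENTRY ON A WINDOW OF RADIUS `ρ`**: `u·u, v·v, w·w ≤ ρ²` (`0 ≤ ρ`) ⟹ `|u·(v × w)| ≤ ρ³` — the homogeneous form a consumer
reads on bond vectors of length `≤ ρ`. [folklore] -/
theorem abs_triple_product_le (u v w : Fin 3 → ℝ) {ρ : ℝ} (hρ : 0 ≤ ρ) (hu : u ⬝ᵥ u ≤ ρ ^ 2) (hv : v ⬝ᵥ v ≤ ρ ^ 2)
    (hw : w ⬝ᵥ w ≤ ρ ^ 2) : |u ⬝ᵥ (v ⨯₃ w)| ≤ ρ ^ 3 := by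
  have h := triple_product_sq_le u v w
  have hu0 : 0 ≤ u ⬝ᵥ u := by unfold dotProduct; exact Finset.sum_nonneg fun i _ => mul_self_nonneg (u i)
  have hv0 : 0 ≤ v ⬝ᵥ v := by unfold dotProduct; exact Finset.sum_nonneg fun i _ => mul_self_nonneg (v i)
  have hw0 : 0 ≤ w ⬝ᵥ w := by unfold dotProduct; exact Finset.sum_nonneg fun i _ => mul_self_nonneg (w i)
  have h2 : (u ⬝ᵥ u) * (v ⬝ᵥ v) ≤ ρ ^ 2 * ρ ^ 2 := mul_le_mul hu hv hv0 (sq_nonneg ρ)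
  have h1 : (u ⬝ᵥ u) * (v ⬝ᵥ v) * (w ⬝ᵥ w) ≤ (ρ ^ 3) ^ 2 := by
    calc (u ⬝ᵥ u) * (v ⬝ᵥ v) * (w ⬝ᵥ w) ≤ ρ ^ 2 * ρ ^ 2 * ρ ^ 2 := mul_le_mul h2 hw hw0 (by positivity)
      _ = (ρ ^ 3) ^ 2 := by ring
  exact abs_le.2 (abs_le_of_sq_le_sq' (h.trans h1) (by positivity))

/-- … and the entry bound is SHARP: at the standard basis `e₀·(e₁ × e₂) = 1` (an orthonormal triple of bond vectors). [folklore] -/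
theorem triple_product_basis : ![1, 0, 0] ⬝ᵥ (![0, 1, 0] ⨯₃ ![0, 0, 1]) = (1 : ℝ) := by
  simp [cross_apply, dotProduct, Fin.sum_univ_three]

end R3

/-! ## §2 The row constant `3√3` in a real inner product space -/

section Row

variable {F : Type*} [NormedAddCommGroup F] [InnerProductSpace ℝ F]

/-- **THE TWO-SUM LEG (Cauchy–Schwarz)**: `‖a‖, ‖b‖, ‖c‖ ≤ ρ` ⟹ `‖a + b‖² + ‖a + c‖² ≤ 4ρ² + 2ρ‖b + c‖`
(`= 2‖a‖² + ‖b‖² + ‖c‖² + 2⟪a, b + c⟫`). [folklore] -/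
theorem norm_add_sq_add_norm_add_sq_le (a b c : F) {ρ : ℝ} (ha : ‖a‖ ≤ ρ) (hb : ‖b‖ ≤ ρ) (hc : ‖c‖ ≤ ρ) :
    ‖a + b‖ ^ 2 + ‖a + c‖ ^ 2 ≤ 4 * ρ ^ 2 + 2 * ρ * ‖b + c‖ := by
  have e1 : ‖a + b‖ ^ 2 + ‖a + c‖ ^ 2 = 2 * ‖a‖ ^ 2 + ‖b‖ ^ 2 + ‖c‖ ^ 2 + 2 * ⟪a, b + c⟫ := by
    rw [norm_add_sq_real, norm_add_sq_real, inner_add_right]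
    ring
  have e2 : ⟪a, b + c⟫ ≤ ‖a‖ * ‖b + c‖ := real_inner_le_norm a (b + c)
  have e3 : ‖a‖ * ‖b + c‖ ≤ ρ * ‖b + c‖ := mul_le_mul_of_nonneg_right ha (norm_nonneg _)
  have h0a := norm_nonneg a
  have h0b := norm_nonneg b
  have h0c := norm_nonneg c
  rw [e1]
  nlinarith [mul_le_mul ha ha h0a (h0a.trans ha), mul_le_mul hb hb h0b (h0b.trans hb),
    mul_le_mul hc hc h0c (h0c.trans hc)]

/-- **THE DIFFERENCE LEG (parallelogram law)**: `‖b‖, ‖c‖ ≤ ρ` ⟹ `‖b − c‖² ≤ 4ρ² − ‖b + c‖²`. [folklore] -/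
theorem norm_sub_sq_le (b c : F) {ρ : ℝ} (hb : ‖b‖ ≤ ρ) (hc : ‖c‖ ≤ ρ) :
    ‖b - c‖ ^ 2 ≤ 4 * ρ ^ 2 - ‖b + c‖ ^ 2 := by
  have e1 := norm_add_sq_real b c
  have e2 := norm_sub_sq_real b c
  have h0b := norm_nonneg b
  have h0c := norm_nonneg c
  nlinarith [mul_le_mul hb hb h0b (h0b.trans hb), mul_le_mul hc hc h0c (h0c.trans hc)]

/-- **FIRST AM–GM LEG**: with `u := ‖b + c‖`, `(‖a + b‖ + ‖a + c‖)·√3 ≤ 5ρ + u` — from `(p + q)² ≤ 2(p² + q²) ≤ 8ρ² + 4ρu` and the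
polynomial certificate `(5ρ + u)² − 3(8ρ² + 4ρu) = (ρ − u)² ≥ 0` (equality at `u = ρ`). [folklore] -/
theorem two_norms_step (a b c : F) {ρ : ℝ} (ha : ‖a‖ ≤ ρ) (hb : ‖b‖ ≤ ρ) (hc : ‖c‖ ≤ ρ) :
    (‖a + b‖ + ‖a + c‖) * √3 ≤ 5 * ρ + ‖b + c‖ := by
  have h1 := norm_add_sq_add_norm_add_sq_le a b c ha hb hc
  have hρ : 0 ≤ ρ := (norm_nonneg a).trans ha
  have hu : 0 ≤ ‖b + c‖ := norm_nonneg _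
  have h3 : (√3) ^ 2 = 3 := Real.sq_sqrt (by norm_num)
  refine (abs_le_of_sq_le_sq' ?_ (by positivity)).2
  have hpq : (‖a + b‖ + ‖a + c‖) ^ 2 ≤ 2 * (‖a + b‖ ^ 2 + ‖a + c‖ ^ 2) := by
    nlinarith [sq_nonneg (‖a + b‖ - ‖a + c‖)]
  calc ((‖a + b‖ + ‖a + c‖) * √3) ^ 2 = (‖a + b‖ + ‖a + c‖) ^ 2 * √3 ^ 2 := by ring
    _ = (‖a + b‖ + ‖a + c‖) ^ 2 * 3 := by rw [h3]
    _ ≤ 2 * (4 * ρ ^ 2 + 2 * ρ * ‖b + c‖) * 3 := by nlinarith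
    _ ≤ (5 * ρ + ‖b + c‖) ^ 2 := by nlinarith [sq_nonneg (ρ - ‖b + c‖)]

/-- **SECOND AM–GM LEG**: with `u := ‖b + c‖`, `‖b − c‖·(2√3)·ρ ≤ 7ρ² − u²` — from `12ρ²‖b − c‖² ≤ 12ρ²(4ρ² − u²)` and the polynomial
certificate `(7ρ² − u²)² − 12ρ²(4ρ² − u²) = (ρ² − u²)² ≥ 0` (equality at `u = ρ`); `7ρ² − u² ≥ 0` because `u ≤ 2ρ`. [folklore] -/
theorem sub_norm_step (b c : F) {ρ : ℝ} (hb : ‖b‖ ≤ ρ) (hc : ‖c‖ ≤ ρ) :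
    ‖b - c‖ * (2 * √3) * ρ ≤ 7 * ρ ^ 2 - ‖b + c‖ ^ 2 := by
  have h2 := norm_sub_sq_le b c hb hc
  have hρ : 0 ≤ ρ := (norm_nonneg b).trans hb
  have hu : 0 ≤ ‖b + c‖ := norm_nonneg _
  have hu2 : ‖b + c‖ ≤ 2 * ρ := by
    calc ‖b + c‖ ≤ ‖b‖ + ‖c‖ := norm_add_le b c
      _ ≤ 2 * ρ := by linarith
  have h3 : (√3) ^ 2 = 3 := Real.sq_sqrt (by norm_num)
  have h7 : 0 ≤ 7 * ρ ^ 2 - ‖b + c‖ ^ 2 := by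
    nlinarith [mul_le_mul hu2 hu2 hu (by positivity : (0 : ℝ) ≤ 2 * ρ)]
  refine (abs_le_of_sq_le_sq' ?_ h7).2
  calc (‖b - c‖ * (2 * √3) * ρ) ^ 2 = 4 * √3 ^ 2 * ρ ^ 2 * ‖b - c‖ ^ 2 := by ring
    _ = 12 * ρ ^ 2 * ‖b - c‖ ^ 2 := by rw [h3]; ring
    _ ≤ 12 * ρ ^ 2 * (4 * ρ ^ 2 - ‖b + c‖ ^ 2) := by
        exact mul_le_mul_of_nonneg_left h2 (by positivity)
    _ ≤ (7 * ρ ^ 2 - ‖b + c‖ ^ 2) ^ 2 := by nlinarith [sq_nonneg (ρ ^ 2 - ‖b + c‖ ^ 2)]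

/-- **THE ROW CONSTANT `G = 3√3`** (ρ-ne7bref-g74-1 (c), the hand proof in kernel): in any real inner product space, three vectors of
length `≤ ρ` satisfy `‖a + b‖ + ‖a + c‖ + ‖b − c‖ ≤ 3·√3·ρ`.  Proof: the two AM–GM legs give
`(sum)·(2√3)·ρ ≤ 2ρ(5ρ + u) + (7ρ² − u²) = 18ρ² − (u − ρ)² ≤ 18ρ²`, `u = ‖b + c‖`. [folklore] -/
theorem row_le (a b c : F) {ρ : ℝ} (ha : ‖a‖ ≤ ρ) (hb : ‖b‖ ≤ ρ) (hc : ‖c‖ ≤ ρ) :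
    ‖a + b‖ + ‖a + c‖ + ‖b - c‖ ≤ 3 * √3 * ρ := by
  have hA := two_norms_step a b c ha hb hc
  have hB := sub_norm_step b c hb hc
  have hρ : 0 ≤ ρ := (norm_nonneg a).trans ha
  have h3 : √3 * √3 = 3 := Real.mul_self_sqrt (by norm_num)
  -- the combined polynomial inequality `(sum)·(2√3·ρ) ≤ 18ρ²`
  have hA' : (‖a + b‖ + ‖a + c‖) * √3 * ρ ≤ (5 * ρ + ‖b + c‖) * ρ := mul_le_mul_of_nonneg_right hA hρ
  have hsum : (‖a + b‖ + ‖a + c‖ + ‖b - c‖) * (2 * √3 * ρ) ≤ 18 * ρ ^ 2 := by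
    nlinarith [sq_nonneg (‖b + c‖ - ρ)]
  rcases hρ.eq_or_lt with h0 | hpos
  · -- `ρ = 0`: all three vectors vanish
    subst h0
    have ha0 : a = 0 := norm_le_zero_iff.1 ha
    have hb0 : b = 0 := norm_le_zero_iff.1 hb
    have hc0 : c = 0 := norm_le_zero_iff.1 hc
    subst ha0 hb0 hc0
    simp
  · -- `ρ > 0`: divide the polynomial inequality by `2√3·ρ > 0`
    have hc' : 0 < 2 * √3 * ρ := by positivity
    have h18 : 18 * ρ ^ 2 = 3 * √3 * ρ * (2 * √3 * ρ) := by
      have : 3 * √3 * ρ * (2 * √3 * ρ) = 6 * (√3 * √3) * ρ ^ 2 := by ring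
      rw [this, h3]; ring
    rw [h18] at hsum
    exact le_of_mul_le_mul_right hsum hc'

/-- The unit form: `‖a‖, ‖b‖, ‖c‖ ≤ 1` ⟹ `‖a + b‖ + ‖a + c‖ + ‖b − c‖ ≤ 3·√3` (the desk's `G ≤ 3√3 = 5.196…`). [folklore] -/
theorem row_le_one (a b c : F) (ha : ‖a‖ ≤ 1) (hb : ‖b‖ ≤ 1) (hc : ‖c‖ ≤ 1) :
    ‖a + b‖ + ‖a + c‖ + ‖b - c‖ ≤ 3 * √3 := by
  simpa using row_le a b c ha hb hc

end Row

/-! ### Sharpness of the row constant: `G = 3√3` is attained -/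

section Sharp

/-- A vector of the Euclidean plane whose squared coordinates sum to `s ≥ 0` has norm `√s`. [folklore] -/
theorem norm_eq_sqrt_fin2 (x : EuclideanSpace ℝ (Fin 2)) {s : ℝ} (h : x 0 ^ 2 + x 1 ^ 2 = s) : ‖x‖ = √s := by
  have h2 : ‖x‖ ^ 2 = x 0 ^ 2 + x 1 ^ 2 := by rw [EuclideanSpace.real_norm_sq_eq, Fin.sum_univ_two]
  rw [← h, ← h2, Real.sqrt_sq (norm_nonneg _)]

/-- **`G = 3√3` IS ATTAINED** (ρ-ne7bref-g74-1: «at `b·c = −½`, `a = b + c`, where `|a+b| = |a+c| = |b−c| = √3`»): the unit vectors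
`b = (1, 0)`, `c = (−½, √3∕2)`, `a = b + c = (½, √3∕2)` of the Euclidean plane give `‖a + b‖ + ‖a + c‖ + ‖b − c‖ = 3·√3`. [folklore] -/
theorem row_sharp :
    ∃ a b c : EuclideanSpace ℝ (Fin 2), ‖a‖ = 1 ∧ ‖b‖ = 1 ∧ ‖c‖ = 1 ∧ ‖a + b‖ + ‖a + c‖ + ‖b - c‖ = 3 * √3 := by
  have h3 : √3 ^ 2 = 3 := Real.sq_sqrt (by norm_num)
  refine ⟨!₂[1 / 2, √3 / 2], !₂[1, 0], !₂[-1 / 2, √3 / 2], ?_, ?_, ?_, ?_⟩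
  · rw [show (1 : ℝ) = √1 from Real.sqrt_one.symm]
    exact norm_eq_sqrt_fin2 _ (by simp; nlinarith [h3])
  · rw [show (1 : ℝ) = √1 from Real.sqrt_one.symm]
    exact norm_eq_sqrt_fin2 _ (by simp)
  · rw [show (1 : ℝ) = √1 from Real.sqrt_one.symm]
    exact norm_eq_sqrt_fin2 _ (by simp; nlinarith [h3])
  · have e1 : ‖!₂[1 / 2, √3 / 2] + !₂[(1 : ℝ), 0]‖ = √3 := norm_eq_sqrt_fin2 _ (by simp; nlinarith [h3])
    have e2 : ‖!₂[1 / 2, √3 / 2] + !₂[-1 / 2, √3 / 2]‖ = √3 := norm_eq_sqrt_fin2 _ (by simp; nlinarith [h3])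
    have e3 : ‖!₂[(1 : ℝ), 0] - !₂[-1 / 2, √3 / 2]‖ = √3 := norm_eq_sqrt_fin2 _ (by simp; nlinarith [h3])
    rw [e1, e2, e3]
    ring

end Sharp

/-! ## §3 The four plaquette rows and the lattice arithmetic -/

section Plaquette

variable {F : Type*} [NormedAddCommGroup F] [InnerProductSpace ℝ F]

/-- **ROW 1 of the plaquette block-norm table** (blocks `(1,2) [x₃+x₄]_×, (1,3) [x₂+x₄]_×, (1,4) [x₂−x₃]_×`): bond vectors of length `≤ ρ`
give `‖x₃ + x₄‖ + ‖x₂ + x₄‖ + ‖x₂ − x₃‖ ≤ 3·√3·ρ` (`row_le` at `(a,b,c) = (x₄, x₃, x₂)`). [folklore] -/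
theorem plaquetteRow₁_le (x₁ x₂ x₃ x₄ : F) {ρ : ℝ} (_h₁ : ‖x₁‖ ≤ ρ) (h₂ : ‖x₂‖ ≤ ρ) (h₃ : ‖x₃‖ ≤ ρ) (h₄ : ‖x₄‖ ≤ ρ) :
    ‖x₃ + x₄‖ + ‖x₂ + x₄‖ + ‖x₂ - x₃‖ ≤ 3 * √3 * ρ := by
  have h := row_le x₄ x₃ x₂ h₄ h₃ h₂
  have e1 : ‖x₃ + x₄‖ = ‖x₄ + x₃‖ := by rw [add_comm]
  have e2 : ‖x₂ + x₄‖ = ‖x₄ + x₂‖ := by rw [add_comm]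
  have e3 : ‖x₂ - x₃‖ = ‖x₃ - x₂‖ := norm_sub_rev x₂ x₃
  rw [e1, e2, e3]
  exact h

/-- **ROW 2** (blocks `(2,1) [x₃+x₄]_×, (2,3) [x₄−x₁]_×, (2,4) [x₁+x₃]_×`): `‖x₃ + x₄‖ + ‖x₄ − x₁‖ + ‖x₁ + x₃‖ ≤ 3·√3·ρ`
(`row_le` at `(a,b,c) = (x₄, x₃, −x₁)`). [folklore] -/
theorem plaquetteRow₂_le (x₁ x₂ x₃ x₄ : F) {ρ : ℝ} (h₁ : ‖x₁‖ ≤ ρ) (_h₂ : ‖x₂‖ ≤ ρ) (h₃ : ‖x₃‖ ≤ ρ) (h₄ : ‖x₄‖ ≤ ρ) :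
    ‖x₃ + x₄‖ + ‖x₄ - x₁‖ + ‖x₁ + x₃‖ ≤ 3 * √3 * ρ := by
  have h := row_le x₄ x₃ (-x₁) h₄ h₃ (by rwa [norm_neg])
  have e1 : ‖x₃ + x₄‖ = ‖x₄ + x₃‖ := by rw [add_comm]
  have e2 : ‖x₄ - x₁‖ = ‖x₄ + -x₁‖ := by rw [sub_eq_add_neg]
  have e3 : ‖x₁ + x₃‖ = ‖x₃ - -x₁‖ := by rw [sub_neg_eq_add, add_comm]
  rw [e1, e2, e3]
  exact h

/-- **ROW 3** (blocks `(3,1) [x₂+x₄]_×, (3,2) [x₄−x₁]_×, (3,4) [x₁+x₂]_×`): `‖x₂ + x₄‖ + ‖x₄ − x₁‖ + ‖x₁ + x₂‖ ≤ 3·√3·ρ`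
(`row_le` at `(a,b,c) = (x₄, x₂, −x₁)`). [folklore] -/
theorem plaquetteRow₃_le (x₁ x₂ x₃ x₄ : F) {ρ : ℝ} (h₁ : ‖x₁‖ ≤ ρ) (h₂ : ‖x₂‖ ≤ ρ) (_h₃ : ‖x₃‖ ≤ ρ) (h₄ : ‖x₄‖ ≤ ρ) :
    ‖x₂ + x₄‖ + ‖x₄ - x₁‖ + ‖x₁ + x₂‖ ≤ 3 * √3 * ρ := by
  have h := row_le x₄ x₂ (-x₁) h₄ h₂ (by rwa [norm_neg])
  have e1 : ‖x₂ + x₄‖ = ‖x₄ + x₂‖ := by rw [add_comm]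
  have e2 : ‖x₄ - x₁‖ = ‖x₄ + -x₁‖ := by rw [sub_eq_add_neg]
  have e3 : ‖x₁ + x₂‖ = ‖x₂ - -x₁‖ := by rw [sub_neg_eq_add, add_comm]
  rw [e1, e2, e3]
  exact h

/-- **ROW 4** (blocks `(4,1) [x₂−x₃]_×, (4,2) [x₁+x₃]_×, (4,3) [x₁+x₂]_×`): `‖x₂ − x₃‖ + ‖x₁ + x₃‖ + ‖x₁ + x₂‖ ≤ 3·√3·ρ`
(`row_le` at `(a,b,c) = (x₁, x₂, x₃)`). [folklore] -/
theorem plaquetteRow₄_le (x₁ x₂ x₃ x₄ : F) {ρ : ℝ} (h₁ : ‖x₁‖ ≤ ρ) (h₂ : ‖x₂‖ ≤ ρ) (h₃ : ‖x₃‖ ≤ ρ) (_h₄ : ‖x₄‖ ≤ ρ) :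
    ‖x₂ - x₃‖ + ‖x₁ + x₃‖ + ‖x₁ + x₂‖ ≤ 3 * √3 * ρ := by
  have h := row_le x₁ x₂ x₃ h₁ h₂ h₃
  linarith

/-- **THE LATTICE ARITHMETIC** (ρ-ne7bref-g74-1: «each bond lying in `2(d−1) = 6` plaquettes … `c_latt ≤ 6·3√3 = 18√3`»): six row sums,
each `≤ 3·√3·ρ` (one per plaquette through a fixed bond at `d = 4`), add up to `≤ 18·√3·ρ`. [folklore] -/
theorem latticeRow_le (r : Fin 6 → ℝ) {ρ : ℝ} (h : ∀ p, r p ≤ 3 * √3 * ρ) : ∑ p, r p ≤ 18 * √3 * ρ := by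
  calc ∑ p, r p ≤ ∑ _p : Fin 6, 3 * √3 * ρ := Finset.sum_le_sum fun p _ => h p
    _ = 18 * √3 * ρ := by
        simp only [Finset.sum_const, Finset.card_univ, Fintype.card_fin, nsmul_eq_mul, Nat.cast_ofNat]; ring

end Plaquette

/-! ## §4 The plaquette cubic on bond vectors of length `≤ ρ`: `|P₃| ≤ 4ρ³`, and `16∕(3√3) ≤ s₃ ≤ 4` -/

section Cubic

/-- **THE TRIVIAL SUP BOUND** `s₃ ≤ 4`: on bond vectors of length `≤ 1` the plaquette cubic
`P₃(x) = x₁·(x₂ × x₃) + x₁·(x₂ × x₄) − x₁·(x₃ × x₄) − x₂·(x₃ × x₄)` has `|P₃(x)| ≤ 4` (four block entries `≤ 1`, §1). [folklore] -/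
theorem plaquetteCubic_abs_le_four (x₁ x₂ x₃ x₄ : Fin 3 → ℝ) (h₁ : x₁ ⬝ᵥ x₁ ≤ 1) (h₂ : x₂ ⬝ᵥ x₂ ≤ 1) (h₃ : x₃ ⬝ᵥ x₃ ≤ 1)
    (h₄ : x₄ ⬝ᵥ x₄ ≤ 1) :
    |x₁ ⬝ᵥ (x₂ ⨯₃ x₃) + x₁ ⬝ᵥ (x₂ ⨯₃ x₄) - x₁ ⬝ᵥ (x₃ ⨯₃ x₄) - x₂ ⬝ᵥ (x₃ ⨯₃ x₄)| ≤ 4 := by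
  have a₁ := abs_le.1 (abs_triple_product_le_one x₁ x₂ x₃ h₁ h₂ h₃)
  have a₂ := abs_le.1 (abs_triple_product_le_one x₁ x₂ x₄ h₁ h₂ h₄)
  have a₃ := abs_le.1 (abs_triple_product_le_one x₁ x₃ x₄ h₁ h₃ h₄)
  have a₄ := abs_le.1 (abs_triple_product_le_one x₂ x₃ x₄ h₂ h₃ h₄)
  rw [abs_le]
  constructor <;> linarith [a₁.1, a₁.2, a₂.1, a₂.2, a₃.1, a₃.2, a₄.1, a₄.2]

/-- **THE SUP BOUND ON A WINDOW OF RADIUS `ρ`**: `x_b·x_b ≤ ρ²` (`0 ≤ ρ`) ⟹ `|P₃(x)| ≤ 4ρ³` (homogeneous form of the previous bound). [folklore] -/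
theorem plaquetteCubic_abs_le (x₁ x₂ x₃ x₄ : Fin 3 → ℝ) {ρ : ℝ} (hρ : 0 ≤ ρ) (h₁ : x₁ ⬝ᵥ x₁ ≤ ρ ^ 2) (h₂ : x₂ ⬝ᵥ x₂ ≤ ρ ^ 2)
    (h₃ : x₃ ⬝ᵥ x₃ ≤ ρ ^ 2) (h₄ : x₄ ⬝ᵥ x₄ ≤ ρ ^ 2) :
    |x₁ ⬝ᵥ (x₂ ⨯₃ x₃) + x₁ ⬝ᵥ (x₂ ⨯₃ x₄) - x₁ ⬝ᵥ (x₃ ⨯₃ x₄) - x₂ ⬝ᵥ (x₃ ⨯₃ x₄)| ≤ 4 * ρ ^ 3 := by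
  have a₁ := abs_le.1 (abs_triple_product_le x₁ x₂ x₃ hρ h₁ h₂ h₃)
  have a₂ := abs_le.1 (abs_triple_product_le x₁ x₂ x₄ hρ h₁ h₂ h₄)
  have a₃ := abs_le.1 (abs_triple_product_le x₁ x₃ x₄ hρ h₁ h₃ h₄)
  have a₄ := abs_le.1 (abs_triple_product_le x₂ x₃ x₄ hρ h₂ h₃ h₄)
  rw [abs_le]
  constructor <;> linarith [a₁.1, a₁.2, a₂.1, a₂.2, a₃.1, a₃.2, a₄.1, a₄.2]

/-- **THE TETRAHEDRAL CERTIFICATE** `s₃ ≥ 16∕(3√3) = 3.0792…` (the desk's E-ne7bref-g74-1 correcting T-71's ascent value `3.047`; F463 (ii):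
«the maximiser's Gram matrix is `±⅓` with the sign pattern of `(y₁, −y₂, −y₃, y₄)`, `y` a regular tetrahedron … each of the four signed
determinants equals `4∕(3√3)`»): the UNIT bond vectors `x₁ = (1,1,1)∕√3`, `x₂ = (−1,1,1)∕√3`, `x₃ = (1,−1,1)∕√3`, `x₄ = (−1,−1,1)∕√3` give
`P₃(x) = 16·√3∕9 = 16∕(3√3)`. [folklore] -/
theorem plaquetteCubic_tetrahedral :
    ∃ x₁ x₂ x₃ x₄ : Fin 3 → ℝ, x₁ ⬝ᵥ x₁ = 1 ∧ x₂ ⬝ᵥ x₂ = 1 ∧ x₃ ⬝ᵥ x₃ = 1 ∧ x₄ ⬝ᵥ x₄ = 1 ∧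
      x₁ ⬝ᵥ (x₂ ⨯₃ x₃) + x₁ ⬝ᵥ (x₂ ⨯₃ x₄) - x₁ ⬝ᵥ (x₃ ⨯₃ x₄) - x₂ ⬝ᵥ (x₃ ⨯₃ x₄) = 16 * √3 / 9 := by
  have h3 : √3 ^ 2 = 3 := Real.sq_sqrt (by norm_num)
  have h3' : √3 ^ 3 = 3 * √3 := by rw [pow_succ, h3]
  refine ⟨![√3 / 3, √3 / 3, √3 / 3], ![-(√3 / 3), √3 / 3, √3 / 3], ![√3 / 3, -(√3 / 3), √3 / 3],
    ![-(√3 / 3), -(√3 / 3), √3 / 3], ?_, ?_, ?_, ?_, ?_⟩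
  · simp [dotProduct, Fin.sum_univ_three]; nlinarith [h3]
  · simp [dotProduct, Fin.sum_univ_three]; nlinarith [h3]
  · simp [dotProduct, Fin.sum_univ_three]; nlinarith [h3]
  · simp [dotProduct, Fin.sum_univ_three]; nlinarith [h3]
  · simp [cross_apply, dotProduct, Fin.sum_univ_three]
    nlinarith [h3, h3']

/-- `16·√3∕9 = 16∕(3√3)` — the two spellings of the certificate's value. [folklore] -/
theorem sixteen_sqrt_three_div_nine : 16 * √3 / 9 = 16 / (3 * √3) := by
  have h3 : √3 * √3 = 3 := Real.mul_self_sqrt (by norm_num)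
  have hs : 0 < √3 := Real.sqrt_pos.2 (by norm_num)
  field_simp
  nlinarith [h3]

end Cubic

end Summit.QuantumFields.BalabanUV.T4Continuum.NE7b.PlaquetteCubicConstants

end
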